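import Mathlib
import HarnessLib
import Literature.MathematicalPhysics.QuantumLattice.HubbardUVCovarianceCTDecayBound
import Summits.HubbardSuperconductivity.HubbardSuperconductivity.Theorems.KLProgrammeKLRegimeEngineScaleZeroCovariance
import Summits.HubbardSuperconductivity.HubbardSuperconductivity.Theorems.KLProgrammeKLRegimeEngineV8Defs

/-!
# Route `KLProgramme`, crux K3 child ENGINE (`KLRegimeEngineV11`, stmt-HubbardSuperconductivity-19823), stub `stub_engine_scale0`, input (I6):
# the DECAY CONSTANT of the scale-`0` covariance on the `4M` time grid for admissible frames, uniform in `M`, `β`, `L`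

Cell gate-hubbard-kl, seat hubbard-kl-k3c4-p2 (technique «Matsubara all-U route»).  The scale-`0` Gaussian step of the engine
(`GrassmannEffectiveActionBoundDB.sum_norm_kernel_effAction_le_of_gramBounded` on the grid algebra of `HubbardGridFieldSubstitution`) takes the
covariance `C = (hubbardGridSub L M β (2(2M)))ᵀ · hubbardCovAboveCT L M β μ 0 K klE0 · hubbardGridSub …` through TWO constants: the Gram/determinant
constant `κ` (k3c2-p1's `isGramBoundedR_scaleZero_of_frameOK`, `…EngineScaleZeroCovariance`) and the decay constant `α` (`hrow`/`hcol`: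
`∀ X, Σ_Y ‖C X Y‖ ≤ α`) — this file.  The Literature side (`HubbardUVCovarianceCTDecayBound.rowSum/colSum_gridSub_hubbardCovAboveCT_le`) gives
`α` explicitly for any frame whose continuum band has bounded first and second derivatives along lattice lines (`UVLineBound μ K D`); here
(§1) that hypothesis is discharged from `FrameOK` (i) (`GeomConstants (frameLevel μ K) 7 …`: all derivatives of order `≤ 2` of `e_K` bounded by
`7` on `Momentum`) with `D = 7`, and (§2) the bound is stated on the engine's grid `N = 2(2M)` at `Λ = klE0`, time rate `s₀ = β·klE0/(2(2M))`.

* `frameLevel_toLp_eq_ctBandFn`, `ctLine_eq_frameLevel_line`, **`uvLineBound_of_frameOK`**;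
* **`rowSum_scaleZero_of_frameOK`**, **`colSum_scaleZero_of_frameOK`** — `hrow`/`hcol` for the scale-`0` covariance of every admissible frame.

What the smallness `θ = e·α·‖V‖_h/κ² < 1` of the step reads is `α·(β/(2(2M)))` (the grid weight of the local vertex); with `s₀ = β·klE0/(2(2M))` every
factor of `β` and `L` in the bound cancels against it except the sharp-truncation edge term `∝ β⁵/M²`, absorbed by the threshold `klEngM₃`.
-/

noncomputable section

namespace Summit.HubbardSuperconductivity.HubbardSuperconductivity.Theorems.ScaleZeroDecay

set_option linter.dupNamespace false -- summit = problem name (single-conjunct summit), D-0017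

open Real Finset Literature.MathematicalPhysics.QuantumLattice Literature.Probability.LatticeModels
open Literature.MathematicalPhysics.QuantumLattice.FermiRG
open Summit.HubbardSuperconductivity.HubbardSuperconductivity.Theorems.KLRegimeSplit
open Summit.HubbardSuperconductivity.HubbardSuperconductivity.Theorems.DispersionFlow
open Summit.HubbardSuperconductivity.HubbardSuperconductivity.Theorems.EngineV8

/-! ## §1 Admissible frames have bounded band geometry along lattice lines: `FrameOK ⟹ UVLineBound μ K 7` -/

/-- The continuum frame band of `HubbardUVSymbolCTDifferences` IS the route's `frameLevel` (on `Momentum = EuclideanSpace ℝ (Fin 2)`). -/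
theorem frameLevel_toLp_eq_ctBandFn (μ : ℝ) (K : TrigPolyC4v) (x : Fin 2 → ℝ) :
    frameLevel μ K (WithLp.toLp 2 x) = ctBandFn μ K x := by
  simp [frameLevel, squareDispersion, ctBandFn]

/-- The lattice line of the band is the restriction of `frameLevel` to the affine line `t ↦ toLp p + t·e_l`. -/
theorem ctLine_eq_frameLevel_line (μ : ℝ) (K : TrigPolyC4v) (p : Fin 2 → ℝ) (l : Fin 2) (t : ℝ) :
    ctLine μ K p l t = frameLevel μ K (ContinuousLinearMap.toSpanSingleton ℝ (EuclideanSpace.single l (1 : ℝ)) t + WithLp.toLp 2 p) := by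
  rw [ctLine, ← frameLevel_toLp_eq_ctBandFn, ContinuousLinearMap.toSpanSingleton_apply]
  congr 1
  ext i
  simp [Pi.single_apply, add_comm]

/-- **`FrameOK ⟹ UVLineBound μ K 7`**: along every lattice line the band `t ↦ e_K(p + t e_l)` of an admissible frame is `C²` with
`|(e_K∘line)′|, |(e_K∘line)″| ≤ 7` (`GeomConstants`: `‖D e_K‖, ‖D² e_K‖ ≤ 7` everywhere; the line has unit speed). -/
theorem uvLineBound_of_frameOK {R : RenConsts} {U : ℝ} {N : ℕ} {μ : ℝ} {K : TrigPolyC4v} (hK : FrameOK R U N μ K) :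
    UVLineBound μ K 7 := by
  intro p l
  set f : EuclideanSpace ℝ (Fin 2) → ℝ := frameLevel μ K with hf
  set v : EuclideanSpace ℝ (Fin 2) := EuclideanSpace.single l (1 : ℝ) with hv
  set Φ : ℝ →L[ℝ] EuclideanSpace ℝ (Fin 2) := ContinuousLinearMap.toSpanSingleton ℝ v with hΦ
  set P : EuclideanSpace ℝ (Fin 2) := WithLp.toLp 2 p with hP
  have hC : ContDiff ℝ 2 f := contDiff_frameLevel μ K
  have hG : GeomConstants f 7 (3 / 80) (1 / 2) (3 / 200) := hK.1
  have hΦnorm : ‖Φ‖ ≤ 1 := by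
    rw [hΦ, ContinuousLinearMap.norm_toSpanSingleton, hv, PiLp.norm_single, norm_one]
  -- the translated band and the line function
  set h : EuclideanSpace ℝ (Fin 2) → ℝ := fun y => f (y + P) with hh
  have hhC : ContDiff ℝ 2 h := hC.comp (contDiff_id.add contDiff_const)
  set g : ℝ → ℝ := h ∘ Φ with hg
  have hgC : ContDiff ℝ 2 g := hhC.comp Φ.contDiff
  have hline : ctLine μ K p l = g := by
    funext t
    rw [ctLine_eq_frameLevel_line, hg, Function.comp_apply, hh]
  -- derivative bounds through the iterated Fréchet derivative
  have hbound : ∀ (k : ℕ), 1 ≤ k → k ≤ 2 → ∀ t : ℝ, ‖iteratedFDeriv ℝ k g t‖ ≤ 7 := by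
    intro k hk1 hk2 t
    rw [hg, ContinuousLinearMap.iteratedFDeriv_comp_right Φ hhC t (i := k) (by exact_mod_cast hk2)]
    refine (ContinuousMultilinearMap.norm_compContinuousLinearMap_le _ _).trans ?_
    have h1 : ‖iteratedFDeriv ℝ k h (Φ t)‖ ≤ 7 := by
      rw [hh, iteratedFDeriv_comp_add_right k P (Φ t)]
      exact hG.norm_iteratedFDeriv_le _ k hk2
    have h2 : ∏ _i : Fin k, ‖Φ‖ ≤ 1 := prod_le_one (fun _ _ => norm_nonneg _) fun _ _ => hΦnorm
    calc ‖iteratedFDeriv ℝ k h (Φ t)‖ * ∏ _i : Fin k, ‖Φ‖ ≤ 7 * 1 := mul_le_mul h1 h2 (by positivity) (by norm_num)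
      _ = 7 := mul_one _
  -- first and second derivative as functions
  have hg1 : ContDiff ℝ 1 (deriv g) := by
    have h2 : ContDiff ℝ (1 + 1) g := by rw [show ((1 : WithTop ℕ∞) + 1) = 2 by norm_num]; exact hgC
    exact (contDiff_succ_iff_deriv.1 h2).2.2
  refine ⟨deriv g, deriv (deriv g), fun t => ?_, fun t => ?_, fun t => ⟨?_, ?_⟩⟩
  · rw [hline]; exact (hgC.differentiable (by norm_num) t).hasDerivAt
  · exact (hg1.differentiable one_ne_zero t).hasDerivAt
  · have := hbound 1 le_rfl (by norm_num) t
    rwa [norm_iteratedFDeriv_eq_norm_iteratedDeriv, iteratedDeriv_one, Real.norm_eq_abs] at this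
  · have := hbound 2 (by norm_num) le_rfl t
    rwa [norm_iteratedFDeriv_eq_norm_iteratedDeriv, iteratedDeriv_succ, iteratedDeriv_one, Real.norm_eq_abs] at this

/-! ## §2 The decay constant of the scale-`0` covariance of an admissible frame on the engine's grid `N = 2(2M)` -/

section Grid

variable {R : RenConsts} {U : ℝ} {Nsc : ℕ} {μ : ℝ} {K : TrigPolyC4v} {β : ℝ} {B₁ B₂ : ℝ} {L M : ℕ} [NeZero L]

/-- `klBetaMin ≤ β ⟹ 0 < β`. -/
theorem beta_pos_of_klBetaMin_le (hβ : klBetaMin ≤ β) : 0 < β := lt_of_lt_of_le (by norm_num [klBetaMin]) hβ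

/-- **`hrow` for the scale-`0` covariance of an admissible frame** on the `2(2M)`-point grid at `Λ = klE0`, explicit in `β, L, M`, the
time rate `s₀ > 0` and the cutoff-derivative bounds `B₁, B₂` (`D = 7` from `FrameOK`):
`Σ_Y ‖(Sᵀ C^K_{>e₀} S) X Y‖ ≤ √((2+12/s₀)·14²)·√(2(2M)·L²·[ℓ²-terms])`. -/
theorem rowSum_scaleZero_of_frameOK (hK : FrameOK R U Nsc μ K) (hβ : klBetaMin ≤ β)
    (hB₁ : ∀ x, |deriv salmhoferCutoff x| ≤ B₁) (hB₂ : ∀ x, |deriv (deriv salmhoferCutoff) x| ≤ B₂) (hM : 2 ≤ M)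
    {s₀ : ℝ} (hs₀ : 0 < s₀) (X : GridLeg (GridPoint L (2 * (2 * M)))) :
    ∑ Y : GridLeg (GridPoint L (2 * (2 * M))),
        ‖((hubbardGridSub L M β (2 * (2 * M))).transpose * hubbardCovAboveCT L M β μ 0 K klE0 *
            hubbardGridSub L M β (2 * (2 * M))) X Y‖ ≤
      Real.sqrt ((2 + 12 / s₀) * 14 ^ 2) *
        Real.sqrt ((((2 * (2 * M) : ℕ) : ℝ)) ^ 1 * (L : ℝ) ^ 2 *
          ((L : ℝ) ^ 2 * ((1 / (β * (L : ℝ) ^ 2)) ^ 2 * (2 * β / klE0)) +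
            ((((2 * (2 * M) : ℕ) : ℝ)) * s₀ / 4) ^ 4 *
              ((L : ℝ) ^ 2 * ((1 / (β * (L : ℝ) ^ 2)) ^ 2 * (2 * Real.pi / β) ^ 4 * (4 * B₂ + 6 * B₁ + 2) ^ 2 *
                  (64 * ((2 / klE0) ^ 4 * (2 * β / klE0)) + (2 / klE0) ^ 6 * (64 * Real.pi))) +
                4 * ((L : ℝ) ^ 2 * (4 * ((1 / (β * (L : ℝ) ^ 2)) ^ 2 * ((β * (L : ℝ) ^ 2) * (β / (Real.pi * (2 * M - 3)))))) ^ 2)) +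
            2 * (((L : ℝ) / 4) ^ 4 *
              ((L : ℝ) ^ 2 * ((1 / (β * (L : ℝ) ^ 2)) ^ 2 * (2 * Real.pi / L) ^ 4 *
                ((7 : ℝ) ^ 2 * (4 * B₂ + 6 * B₁ + 2) * (2 / klE0) + 7 * (2 * B₁ + 1)) ^ 2 * ((2 / klE0) ^ (2 * 1) * (2 * β / klE0))))))) := by
  haveI : NeZero (2 * (2 * M)) := ⟨by omega⟩
  exact rowSum_gridSub_hubbardCovAboveCT_le (beta_pos_of_klBetaMin_le hβ) (by norm_num [klE0]) hB₁ hB₂ (by norm_num)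
    (uvLineBound_of_frameOK hK) hM (by omega) hs₀ X

/-- **`hcol` for the scale-`0` covariance of an admissible frame** (same bound for the column sums). -/
theorem colSum_scaleZero_of_frameOK (hK : FrameOK R U Nsc μ K) (hβ : klBetaMin ≤ β)
    (hB₁ : ∀ x, |deriv salmhoferCutoff x| ≤ B₁) (hB₂ : ∀ x, |deriv (deriv salmhoferCutoff) x| ≤ B₂) (hM : 2 ≤ M)
    {s₀ : ℝ} (hs₀ : 0 < s₀) (Y : GridLeg (GridPoint L (2 * (2 * M)))) :
    ∑ X : GridLeg (GridPoint L (2 * (2 * M))),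
        ‖((hubbardGridSub L M β (2 * (2 * M))).transpose * hubbardCovAboveCT L M β μ 0 K klE0 *
            hubbardGridSub L M β (2 * (2 * M))) X Y‖ ≤
      Real.sqrt ((2 + 12 / s₀) * 14 ^ 2) *
        Real.sqrt ((((2 * (2 * M) : ℕ) : ℝ)) ^ 1 * (L : ℝ) ^ 2 *
          ((L : ℝ) ^ 2 * ((1 / (β * (L : ℝ) ^ 2)) ^ 2 * (2 * β / klE0)) +
            ((((2 * (2 * M) : ℕ) : ℝ)) * s₀ / 4) ^ 4 *
              ((L : ℝ) ^ 2 * ((1 / (β * (L : ℝ) ^ 2)) ^ 2 * (2 * Real.pi / β) ^ 4 * (4 * B₂ + 6 * B₁ + 2) ^ 2 *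
                  (64 * ((2 / klE0) ^ 4 * (2 * β / klE0)) + (2 / klE0) ^ 6 * (64 * Real.pi))) +
                4 * ((L : ℝ) ^ 2 * (4 * ((1 / (β * (L : ℝ) ^ 2)) ^ 2 * ((β * (L : ℝ) ^ 2) * (β / (Real.pi * (2 * M - 3)))))) ^ 2)) +
            2 * (((L : ℝ) / 4) ^ 4 *
              ((L : ℝ) ^ 2 * ((1 / (β * (L : ℝ) ^ 2)) ^ 2 * (2 * Real.pi / L) ^ 4 *
                ((7 : ℝ) ^ 2 * (4 * B₂ + 6 * B₁ + 2) * (2 / klE0) + 7 * (2 * B₁ + 1)) ^ 2 * ((2 / klE0) ^ (2 * 1) * (2 * β / klE0))))))) := by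
  haveI : NeZero (2 * (2 * M)) := ⟨by omega⟩
  exact colSum_gridSub_hubbardCovAboveCT_le (beta_pos_of_klBetaMin_le hβ) (by norm_num [klE0]) hB₁ hB₂ (by norm_num)
    (uvLineBound_of_frameOK hK) hM (by omega) hs₀ Y

end Grid

/-! ## §3 The `M`-, `β`-, `L`-uniform form: `(β/(2(2M)))·α ≤ A₀(B₁, B₂)` at the time rate `s₀ = β·klE0/(2(2M))` -/

section Alpha

variable {R : RenConsts} {U : ℝ} {Nsc : ℕ} {μ : ℝ} {K : TrigPolyC4v} {β : ℝ} {B₁ B₂ : ℝ} {L M : ℕ} [NeZero L]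

set_option maxHeartbeats 400000 in
/-- **The radicand algebra**: with `s₀ = βΛ/N` the product `(β/N)²·(2+12/s₀)·14²·N·L²·[ℓ²-terms]` equals
`196·(2β/N + 12/Λ)·(2/Λ + 128π⁴K₂²/Λ + 256π⁵K₂²/(βΛ²) + β⁵Λ⁴/(4π²(2M-3)²) + π⁴K_x²/Λ³)` — every `L` and all but the displayed `β`'s cancel. -/
theorem radicand_scaleZero_eq {N' Lr β' Λ K₂ Kx Mr : ℝ} (hN : N' ≠ 0) (hL : Lr ≠ 0) (hβ : β' ≠ 0) (hΛ : Λ ≠ 0) (hM : 2 * Mr - 3 ≠ 0) :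
    (β' / N') ^ 2 * (((2 + 12 / (β' * Λ / N')) * 14 ^ 2) * (N' ^ 1 * Lr ^ 2 *
      (Lr ^ 2 * ((1 / (β' * Lr ^ 2)) ^ 2 * (2 * β' / Λ)) +
        (N' * (β' * Λ / N') / 4) ^ 4 *
          (Lr ^ 2 * ((1 / (β' * Lr ^ 2)) ^ 2 * (2 * Real.pi / β') ^ 4 * K₂ ^ 2 *
              (64 * ((2 / Λ) ^ 4 * (2 * β' / Λ)) + (2 / Λ) ^ 6 * (64 * Real.pi))) +
            4 * (Lr ^ 2 * (4 * ((1 / (β' * Lr ^ 2)) ^ 2 * ((β' * Lr ^ 2) * (β' / (Real.pi * (2 * Mr - 3)))))) ^ 2)) +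
        2 * ((Lr / 4) ^ 4 * (Lr ^ 2 * ((1 / (β' * Lr ^ 2)) ^ 2 * (2 * Real.pi / Lr) ^ 4 * Kx ^ 2 *
          ((2 / Λ) ^ (2 * 1) * (2 * β' / Λ)))))))) =
      196 * ((2 * β' / N' + 12 / Λ) * (2 / Λ + 128 * Real.pi ^ 4 * K₂ ^ 2 / Λ + 256 * Real.pi ^ 5 * K₂ ^ 2 / (β' * Λ ^ 2) +
        β' ^ 5 * Λ ^ 4 / (4 * Real.pi ^ 2 * (2 * Mr - 3) ^ 2) + Real.pi ^ 4 * Kx ^ 2 / Λ ^ 3)) := by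
  have hπ : Real.pi ≠ 0 := Real.pi_ne_zero
  rw [show (2 : ℕ) * 1 = 2 from rfl, pow_one]
  field_simp
  ring

/-- The last step, abstractly: `S ≤ √a·√b`, `c²(ab) ≤ 196 Q`, `c ≥ 0` give `c·S ≤ 14√Q`. -/
theorem mul_le_fourteen_sqrt_of_le {S a b c Q : ℝ} (hS : S ≤ Real.sqrt a * Real.sqrt b) (ha : 0 ≤ a) (hc : 0 ≤ c)
    (hQ : c ^ 2 * (a * b) ≤ 196 * Q) : c * S ≤ 14 * Real.sqrt Q := by
  calc c * S ≤ c * (Real.sqrt a * Real.sqrt b) := mul_le_mul_of_nonneg_left hS hc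
    _ = Real.sqrt (c ^ 2 * (a * b)) := by rw [Real.sqrt_mul (sq_nonneg _), Real.sqrt_sq hc, Real.sqrt_mul ha]
    _ ≤ Real.sqrt (196 * Q) := Real.sqrt_le_sqrt hQ
    _ = 14 * Real.sqrt Q := by
        rw [Real.sqrt_mul (by norm_num), show (196 : ℝ) = 14 ^ 2 by norm_num, Real.sqrt_sq (by norm_num)]

/-- **The decay constant of the scale-`0` covariance is `O(1)` against the grid weight**: for an admissible frame, `klBetaMin ≤ β` and
`β³ ≤ M`, on the `2(2M)` grid,
`(β/(2(2M)))·Σ_Y ‖(Sᵀ C^K_{>e₀} S) X Y‖ ≤ 14·√((1/2 + 12/e₀)(2/e₀ + 128π⁴K₂²/e₀ + 2π⁵K₂²/e₀² + 1 + π⁴K_x²/e₀³))`,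
`K₂ = 4B₂ + 6B₁ + 2`, `K_x = 7²K₂·(2/e₀) + 7(2B₁+1)`, `e₀ = klE0 = 1/32` — uniform in `M`, `β`, `L`, `μ`, `U`, the frame (the product
`α·(β/N)` is what the smallness `θ` of `sum_norm_kernel_effAction_le_of_gramBounded` reads, the grid vertex carrying the weight `β/N`). -/
theorem alpha_scaleZero_le (hK : FrameOK R U Nsc μ K) (hβ : klBetaMin ≤ β)
    (hB₁ : ∀ x, |deriv salmhoferCutoff x| ≤ B₁) (hB₂ : ∀ x, |deriv (deriv salmhoferCutoff) x| ≤ B₂) (hβM : β ^ 3 ≤ (M : ℝ))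
    (X : GridLeg (GridPoint L (2 * (2 * M)))) :
    β / (((2 * (2 * M) : ℕ) : ℝ)) * ∑ Y : GridLeg (GridPoint L (2 * (2 * M))),
        ‖((hubbardGridSub L M β (2 * (2 * M))).transpose * hubbardCovAboveCT L M β μ 0 K klE0 *
            hubbardGridSub L M β (2 * (2 * M))) X Y‖ ≤
      14 * Real.sqrt ((1 / 2 + 12 / klE0) *
        (2 / klE0 + 128 * Real.pi ^ 4 * (4 * B₂ + 6 * B₁ + 2) ^ 2 / klE0 + 2 * Real.pi ^ 5 * (4 * B₂ + 6 * B₁ + 2) ^ 2 / klE0 ^ 2 + 1 +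
          Real.pi ^ 4 * ((7 : ℝ) ^ 2 * (4 * B₂ + 6 * B₁ + 2) * (2 / klE0) + 7 * (2 * B₁ + 1)) ^ 2 / klE0 ^ 3)) := by
  have hβ0 : 0 < β := beta_pos_of_klBetaMin_le hβ
  have hβ128 : (128 : ℝ) ≤ β := by simpa [klBetaMin] using hβ
  have hΛ : (0 : ℝ) < klE0 := by norm_num [klE0]
  have hL : (0 : ℝ) < L := by exact_mod_cast Nat.pos_of_ne_zero (NeZero.ne L)
  have hβ3 : β ≤ β ^ 3 := by nlinarith [sq_nonneg β]
  have hMr : β ≤ (M : ℝ) := hβ3.trans hβM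
  have hM2 : 2 ≤ M := by
    have : (2 : ℝ) ≤ M := by linarith
    exact_mod_cast this
  have hM3 : (3 : ℝ) ≤ M := by linarith
  have hN4 : (((2 * (2 * M) : ℕ) : ℝ)) = 4 * M := by push_cast; ring
  have hN0 : 0 < (((2 * (2 * M) : ℕ) : ℝ)) := by rw [hN4]; positivity
  have hs₀pos : 0 < β * klE0 / (((2 * (2 * M) : ℕ) : ℝ)) := by positivity
  have hrow := rowSum_scaleZero_of_frameOK (L := L) hK hβ hB₁ hB₂ hM2 hs₀pos X
  refine mul_le_fourteen_sqrt_of_le hrow (by positivity) (by positivity) ?_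
  rw [radicand_scaleZero_eq hN0.ne' hL.ne' hβ0.ne' hΛ.ne' (by linarith)]
  refine mul_le_mul_of_nonneg_left ?_ (by norm_num)
  have hB10 : 0 ≤ B₁ := (abs_nonneg _).trans (hB₁ 0)
  have hB20 : 0 ≤ B₂ := (abs_nonneg _).trans (hB₂ 0)
  have h1 : 2 * β / (((2 * (2 * M) : ℕ) : ℝ)) + 12 / klE0 ≤ 1 / 2 + 12 / klE0 := by
    have : 2 * β / (((2 * (2 * M) : ℕ) : ℝ)) ≤ 1 / 2 := by rw [div_le_iff₀ hN0, hN4]; linarith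
    linarith
  have hT3 : 256 * Real.pi ^ 5 * (4 * B₂ + 6 * B₁ + 2) ^ 2 / (β * klE0 ^ 2) ≤
      2 * Real.pi ^ 5 * (4 * B₂ + 6 * B₁ + 2) ^ 2 / klE0 ^ 2 := by
    rw [div_le_div_iff₀ (by positivity) (by positivity)]
    have : 0 ≤ Real.pi ^ 5 * (4 * B₂ + 6 * B₁ + 2) ^ 2 * klE0 ^ 2 := by positivity
    nlinarith
  have hT4 : β ^ 5 * klE0 ^ 4 / (4 * Real.pi ^ 2 * (2 * M - 3) ^ 2) ≤ 1 := by
    have hM' : β ^ 3 ≤ 2 * (M : ℝ) - 3 := by linarith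
    have h6 : (β ^ 3) ^ 2 ≤ (2 * (M : ℝ) - 3) ^ 2 := pow_le_pow_left₀ (by positivity) hM' 2
    have hπ2 : 9 ≤ Real.pi ^ 2 := by nlinarith [Real.pi_gt_three]
    have hden : (0 : ℝ) < 4 * Real.pi ^ 2 * (2 * M - 3) ^ 2 := by
      have : (0 : ℝ) < 2 * M - 3 := by linarith
      positivity
    rw [div_le_one hden, show klE0 ^ 4 = (1 : ℝ) / 2 ^ 20 by norm_num [klE0]]
    have hβ5 : β ^ 5 ≤ (β ^ 3) ^ 2 := by
      rw [← pow_mul, show 3 * 2 = 5 + 1 from rfl, pow_succ]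
      exact le_mul_of_one_le_right (by positivity) (by linarith)
    nlinarith [pow_pos hβ0 5]
  have hpos : 0 ≤ 2 / klE0 + 128 * Real.pi ^ 4 * (4 * B₂ + 6 * B₁ + 2) ^ 2 / klE0 +
      256 * Real.pi ^ 5 * (4 * B₂ + 6 * B₁ + 2) ^ 2 / (β * klE0 ^ 2) + β ^ 5 * klE0 ^ 4 / (4 * Real.pi ^ 2 * (2 * M - 3) ^ 2) +
      Real.pi ^ 4 * ((7 : ℝ) ^ 2 * (4 * B₂ + 6 * B₁ + 2) * (2 / klE0) + 7 * (2 * B₁ + 1)) ^ 2 / klE0 ^ 3 := by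
    have : (0 : ℝ) < 2 * M - 3 := by linarith
    positivity
  refine mul_le_mul h1 ?_ hpos (by positivity)
  linarith

omit [NeZero L] in
/-- **The engine's thresholds give `β³ ≤ M`**: `klEngL₃ β U ≤ L` puts `β ≤ L`, and `klEngM₃ β U L = 2^{10}(⌈|β|⌉₊+1)²(L+1)² ≤ M` then gives
`β⁴ ≤ M`. -/
theorem pow_three_le_of_klEng (hβ : klBetaMin ≤ β) (hL : klEngL₃ β U ≤ L) (hM : klEngM₃ β U L ≤ M) : β ^ 3 ≤ (M : ℝ) := by
  have hβ1 : (1 : ℝ) ≤ β := le_trans (by norm_num [klBetaMin]) hβ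
  have hβL : β ≤ L := le_of_klEngL₃_le hL
  unfold klEngM₃ at hM
  have h3 : ((2 ^ 10 * (⌈|β|⌉₊ + 1) ^ 2 * (L + 1) ^ 2 : ℕ) : ℝ) ≤ (M : ℝ) := by exact_mod_cast hM
  push_cast at h3
  have hb : β ≤ (⌈|β|⌉₊ : ℝ) + 1 := by
    have h1 : |β| ≤ (⌈|β|⌉₊ : ℝ) := Nat.le_ceil _
    linarith [le_abs_self β]
  have hb2 : β ^ 2 ≤ ((⌈|β|⌉₊ : ℝ) + 1) ^ 2 := pow_le_pow_left₀ (by linarith) hb 2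
  have hL2 : β ^ 2 ≤ ((L : ℝ) + 1) ^ 2 := pow_le_pow_left₀ (by linarith) (by linarith) 2
  have h4 : β ^ 2 * β ^ 2 ≤ ((⌈|β|⌉₊ : ℝ) + 1) ^ 2 * ((L : ℝ) + 1) ^ 2 := mul_le_mul hb2 hL2 (by positivity) (by positivity)
  have h5 : ((⌈|β|⌉₊ : ℝ) + 1) ^ 2 * ((L : ℝ) + 1) ^ 2 ≤ 1024 * ((⌈|β|⌉₊ : ℝ) + 1) ^ 2 * ((L : ℝ) + 1) ^ 2 := by
    have : 0 ≤ ((⌈|β|⌉₊ : ℝ) + 1) ^ 2 * ((L : ℝ) + 1) ^ 2 := by positivity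
    nlinarith
  calc β ^ 3 ≤ β ^ 2 * β ^ 2 := by nlinarith [pow_pos (by linarith : (0:ℝ) < β) 2]
    _ ≤ (M : ℝ) := h4.trans (h5.trans h3)

end Alpha

end Summit.HubbardSuperconductivity.HubbardSuperconductivity.Theorems.ScaleZeroDecay

end
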